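import Summits.BirchSwinnertonDyer.Rank1Residual.X2.RankOneManin
import Summits.BirchSwinnertonDyer.Rank1Residual.X11b.BDPRouteDescent
import Literature.NumberTheory.EllipticCurves.KrizLi2019.SexticTwistBSDThreeDescent
import Literature.NumberTheory.EllipticCurves.BSDHeegnerPointsGrossZagierProofs
import Literature.NumberTheory.EllipticCurves.KolyvaginShaIndexBound
import Literature.NumberTheory.EllipticCurves.Rank1Residual.PrintShape
import Literature.NumberTheory.EllipticCurves.GlobalMinimalModel
import HarnessLib

/-!
# Class X2, rank `1` (sub-cell X2c): the exact descent `K → ℚ` run BACKWARDS — `BSD(E,p)` and the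
# partner's print shape imply the Heegner-index identity over `K` (cell `b2b-bsdres`, unit
# `b2b-bsdres-eisenstein-p2`, gen 3)

HONEST FRAMING (run/shared/lean/b2b/bsd-rank1-residual/, verbatim in every file): the goal of the
cell is to DELETE the COMBINATION-SHAPED residual classes of the Birch–Swinnerton-Dyer formula for
ALL analytic-rank `≤ 1` elliptic curves over `ℚ` — "full BSD formula for every rank `≤ 1` curve in
class `C`" assembled STRICTLY from published theorems — so that the rank-`≤ 1` remainder becomes
exactly the CONSTRUCTION-SHAPED classes, which are TYPED (missing-input `Prop`s), NOT attempted.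
This is not "finishing BSD". Research routes; no claim beyond stated classes. X2c stays
CONSTRUCTION-SHAPED. ONE theorem (no definition, no named fact).

`indexIdentityAt_of_bsdp` — multr1-p2's exact descent `X11b.bsdp_of_indexIdentityAt`
(`X11b/BDPRouteDescent.lean`, p199961: Gross–Zagier `L'(E/K,1) = (4B/(c²w²))·ĥ(P_K)`, the
Néron-period relation `Ω_E Ω_{E^D} = n·B`, `ĥ(P) = 2I²Reg/(m t_K²)`, `L'(E/K,1) = L'(E,1)L(E^D,1)`,
the rank-zero print shape of `E^D`, and the valuations of torsion and `Ш` under `K/ℚ` at odd `p`,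
giving `#Ш_an(E) = 8 I² t_E² / (n m t_K² c² w² q_d |u| c_E)`) with INPUT and OUTPUT exchanged:
from `BSD(E,p)` (`ord_p #Ш_an(E) = ord_p #Ш(E)`) the same bookkeeping yields the identity
`2·ord_p ∏c_ℓ(E) + ord_p #Ш(E/K) = 2·ord_p [E(K):ℤP_K]` (`X11b.IndexIdentityAt`). The proof is that
proof verbatim — same tree lemmas, same abbreviations — with the last step inverted. Used by
`X2/RankOneHeegnerExact.lean` (`X2.Target ⟹ X2.HeegnerIndexIdentity`; joint exactness of X2's two
typed inputs).

References: [JetchevSkinnerWan2017] §7.4.1 (p. 30); [GrossZagier1986] V.§2; [Castella2018] §5;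
[KolyvaginEulerSystems1990] Thm. A; [Miller2011LMS] Def. 1.1; [KrizLi2019] §10.3 (shape).
-/


set_option autoImplicit false

noncomputable section

open scoped Classical MatrixGroups ModularForm

open CongruenceSubgroup WeierstrassCurve NumberField Literature.NumberTheory.EllipticCurves
  Literature.NumberTheory.EllipticCurves.ModularForms Literature.NumberTheory.QuadraticFields
  Literature.NumberTheory.EllipticCurves.Rank1Residual
  Literature.NumberTheory.EllipticCurves.Rank1Residual.Typed
  Literature.NumberTheory.EllipticCurves.KrizLi2019
  Literature.NumberTheory.EllipticCurves.GreenbergVatsal2000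
  Literature.NumberTheory.EllipticCurves.Wuthrich2014
  Literature.NumberTheory.EllipticCurves.SteinWuthrich2013

namespace Summit.BirchSwinnertonDyer.Rank1Residual.X2

/-! ### The exact descent, backwards: `BSD(E,p)` + the partner's print shape ⟹ the identity over `K` -/

/-- **`BSD(E,p)` + the rank-zero print shape of `E^{d_K}` ⟹ the Heegner-index identity over `K`.**
Same data and published binders as `X11b.bsdp_of_indexIdentityAt` (`hGZ` Gross–Zagier / Cai–Shu–Tian,
`hKo` Kolyvagin, `hGZK`, `hmod`): `K` imaginary quadratic with the Heegner hypothesis for the level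
`N` of the datum `Dt` (`p ∤ c(Dt)`, `p ∤ w_K`), `P` its Heegner point, `ord L(E,s) = 1`,
`L(E^{d_K},1) ≠ 0`, a globally minimal `Wd = Cd • E^{(d_K)}` with its print shape `htw` and the two
transport values; INPUT `BSDp W p`; CONCLUSION `X11b.IndexIdentityAt W p K P`. The computation of
`#Ш_an(E) = 8 I² t_E² / (n m t_K² c² w² q_d |u| c_E)` and of the valuations is multr1-p2's
(p199961) verbatim; only the last step is inverted (`BSD(E,p)` pins `ord_p #Ш_an(E) = ord_p #Ш(E)`,
whence `2·ord_p ∏c_ℓ + ord_p #Ш(E/K) = 2·ord_p I`). [cite: JetchevSkinnerWan2017, §7.4.1 (eq:gz for K′), p. 30]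
[cite: GrossZagier1986, V.§2 (pp. 310–312)] [cite: Castella2018, §5 (p. 12)] [cite: Miller2011LMS, Def. 1.1] -/
theorem indexIdentityAt_of_bsdp
    (W : WeierstrassCurve ℚ) [W.IsElliptic] [W.IsGloballyMinimal] (p : ℕ) [Fact p.Prime]
    (N : ℕ) [NeZero N] (K : Type) [Field K] [NumberField K]
    (Dt : ModularParametrizationData W N) (H : HeegnerDatum N (NumberField.discr K)) (ι : K →+* ℂ)
    (P : (W.baseChange K).toAffine.Point)
    -- the published inputs (named facts of the tree)
    (hGZ : gross_zagier N W K) (hKo : kolyvagin N W K)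
    (hGZK : rank_eq_analyticRank_of_analyticRank_le_one) (hmod : hasEntireLFunction_rat)
    -- the data
    (hK : IsImaginaryQuadratic K) (hHN : SatisfiesHeegnerHypothesis N K)
    (hP : WeierstrassCurve.Affine.Point.map ι.toRatAlgHom P = heegnerPointComplex Dt H)
    (hp2 : p ≠ 2) (hc : ¬ (p : ℤ) ∣ Dt.c) (hμ : ¬ p ∣ Units.torsionOrder K)
    (hr : W.analyticRank = 1)
    (hLt : (W.quadraticTwist (NumberField.discr K : ℚ)).entireLFunction 1 ≠ 0)
    -- a globally minimal model of the quadratic twist by `d_K`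
    (Wd : WeierstrassCurve ℚ) [Wd.IsElliptic] [Wd.IsGloballyMinimal] (Cd : VariableChange ℚ)
    (hWd : Cd • W.quadraticTwist (NumberField.discr K : ℚ) = Wd)
    -- the rank-zero `p`-part of the twist, print shape of bsd.S30 / Skinner 2016 Thm. C
    (htw : ∃ q : ℚ, Wd.entireLFunction 1 / (Wd.realPeriodRat : ℂ) = (q : ℂ) ∧
      padicValRat p q = (padicValNat p Wd.shaOrder : ℤ) + padicValNat p Wd.tamagawaProduct -
        2 * padicValNat p Wd.torsionOrder)
    -- the two decidable side conditions
    (htam : padicValNat p Wd.tamagawaProduct = padicValNat p W.tamagawaProduct)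
    (hu : padicValRat p (Cd.u : ℚ) = 0)
    -- `BSD(E,p)` for `E` itself
    (hbsd : BSDp W p) : X11b.IndexIdentityAt W p K P := by
  unfold X11b.IndexIdentityAt
  have hpp : p.Prime := Fact.out
  haveI hEK : (W.baseChange K).IsElliptic := isElliptic_baseChange' W K
  obtain ⟨h2, hKtc⟩ := hK
  haveI : IsTotallyComplex K := hKtc
  have hD0 : (NumberField.discr K : ℚ) ≠ 0 := by exact_mod_cast NumberField.discr_ne_zero K
  haveI hEt : (W.quadraticTwist (NumberField.discr K : ℚ)).IsElliptic :=
    W.isElliptic_quadraticTwist hD0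
  ---------------------------------------------------------------- `L`-values over `ℚ` and `K`
  have hL0 : W.entireLFunction 1 = 0 := entireLFunction_one_eq_zero_of_analyticRank_eq_one hr
  obtain ⟨hlead, hderiv⟩ := leadingLCoeff_eq_deriv_of_analyticRank_eq_one hr
  have hprod := lDerivEK_eq_deriv_mul W K hmod hL0
  have hLK : LDerivEK W K ≠ 0 := by
    rw [hprod]; exact mul_ne_zero hderiv hLt
  ---------------------------------------------------------------- the Heegner point is non-torsion; Kolyvagin
  have hPH : IsHeegnerPoint N W K P := ⟨Dt, H, ι, hP⟩
  have hPinf : ¬ IsOfFinAddOrder P :=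
    (lDerivEK_ne_zero_iff_not_isOfFinAddOrder W N K hGZ ⟨h2, hKtc⟩ hHN hPH).mp hLK
  obtain ⟨hrkK, hShaK⟩ := hKo ⟨h2, hKtc⟩ hHN hPH hPinf
  haveI hfinK : Finite (W.baseChange K).sha := hShaK
  have hShaW : W.ShaFinite := Literature.NumberTheory.EllipticCurves.shaFinite_of_baseChange W K hShaK
  haveI hfinW : Finite W.sha := hShaW
  ---------------------------------------------------------------- analytic ranks
  have hrt : (W.quadraticTwist (NumberField.discr K : ℚ)).analyticRank = 0 :=
    ((W.quadraticTwist _).analyticRank_eq_zero_iff_holds (hmod _)).2 hLt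
  have hrd : Wd.analyticRank = 0 := by rw [← hWd, analyticRank_smul, hrt]
  ---------------------------------------------------------------- Gross–Zagier–Kolyvagin for `W` and `Wd`
  have hr1 : W.analyticRank ≤ 1 := le_of_eq hr
  have hrQ : W.mordellWeilRank = 1 := by rw [(hGZK W hr1).1, hr]
  have hrd1 : Wd.analyticRank ≤ 1 := by omega
  obtain ⟨hrankd, hShad⟩ := hGZK Wd hrd1
  have hrkd : Wd.mordellWeilRank = 0 := by rw [hrankd, hrd]
  haveI hfind : Finite Wd.toAffine.Point := Wd.mordellWeilRank_eq_zero_iff_holds.mp hrkd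
  haveI hfinSd : Finite Wd.sha := hShad
  have htdeq : Wd.torsionOrder = Nat.card Wd.toAffine.Point := Wd.torsionOrder_eq_natCard_of_finite
  ---------------------------------------------------------------- heights and index (Kriz–Li §2)
  obtain ⟨m, hm, hheight⟩ :=
    exists_mul_canonicalHeight_eq_index_sq_mul_regulator W K h2 hrkK hrQ P hPinf
  ---------------------------------------------------------------- Gross–Zagier and the period
  have hLD := (hGZ ⟨h2, hKtc⟩ hHN) Dt H ι P hP
  have hper := two_mul_covolume_div_sqrt_eq_bsdPeriod W K Dt h2
  have hΩ := W.realPeriod_mul_realPeriod_quadraticTwist_eq_mul_bsdPeriod K h2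
  have hΩd : Wd.realPeriodRat =
      |((Cd.u : ℚ) : ℝ)| * (W.quadraticTwist (NumberField.discr K : ℚ)).realPeriodRat := by
    rw [← hWd]; exact realPeriodRat_smul_holds (W.quadraticTwist _) Cd
  have hLt' : (W.quadraticTwist (NumberField.discr K : ℚ)).entireLFunction = Wd.entireLFunction := by
    rw [← hWd, entireLFunction_smul]
  ---------------------------------------------------------------- the twist's `L`-value
  obtain ⟨qd, hqd, hvqd⟩ := htw
  have hΩdpos : 0 < Wd.realPeriodRat := Wd.realPeriodRat_pos_holds
  have hΩdC : (Wd.realPeriodRat : ℂ) ≠ 0 := by exact_mod_cast hΩdpos.ne'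
  have hLd : Wd.entireLFunction 1 = (((qd : ℝ) * Wd.realPeriodRat : ℝ) : ℂ) := by
    have := (div_eq_iff hΩdC).mp hqd
    rw [this]; push_cast; ring
  have hLd1 : Wd.entireLFunction 1 ≠ 0 := by rw [← hLt']; exact hLt
  have hqd0 : qd ≠ 0 := by
    intro h0
    apply hLd1
    rw [hLd, h0]; simp
  ---------------------------------------------------------------- positivity of everything
  have hΩW : 0 < W.realPeriodRat := W.realPeriodRat_pos_holds
  have hΩt : 0 < (W.quadraticTwist (NumberField.discr K : ℚ)).realPeriodRat :=
    (W.quadraticTwist _).realPeriodRat_pos_holds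
  have hR : 0 < W.regulator := W.regulator_pos'
  have hcW : 0 < W.tamagawaProduct := W.tamagawaProduct_pos_holds
  have hcd : 0 < Wd.tamagawaProduct := Wd.tamagawaProduct_pos_holds
  have htW : 0 < W.torsionOrder := W.torsionOrder_pos_holds
  have htK : 0 < (W.baseChange K).torsionOrder := (W.baseChange K).torsionOrder_pos_holds
  have htd : 0 < Nat.card Wd.toAffine.Point := Nat.card_pos
  have hSd : 0 < Wd.shaOrder := Wd.shaOrder_pos hShad
  have hcM : (Dt.c : ℚ) ≠ 0 := by
    have : Dt.c ≠ 0 := by rintro h0; exact hc (h0 ▸ dvd_zero (p : ℤ))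
    exact_mod_cast this
  have hw : 0 < Units.torsionOrder K := Units.torsionOrder_pos K
  have huu : (Cd.u : ℚ) ≠ 0 := Cd.u.ne_zero
  have hm0 : 0 < m := by rcases hm with rfl | rfl <;> norm_num
  have hI0 : (AddSubgroup.zmultiples P).index ≠ 0 := by
    intro hI
    rw [hI] at hheight
    have h0 : (m : ℝ) * ((W.baseChange K).torsionOrder : ℝ) ^ 2 * P.canonicalHeight = 0 := by
      rw [hheight]; simp
    have hh0 : P.canonicalHeight = 0 := by
      rcases mul_eq_zero.mp h0 with h' | h'
      · rcases mul_eq_zero.mp h' with h'' | h''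
        · exact absurd (by exact_mod_cast h'' : m = 0) hm0.ne'
        · exact absurd (pow_eq_zero_iff two_ne_zero |>.mp h'') (by exact_mod_cast htK.ne')
      · exact h'
    exact hPinf ((Affine.Point.canonicalHeight_eq_zero_iff_holds P).mp hh0)
  set n := (W.baseChange ℝ).numRealComponents with hn_def
  have hn : n = 1 ∨ n = 2 := numRealComponents_eq_one_or W
  have hn0 : 0 < n := by rcases hn with h' | h' <;> omega
  ---------------------------------------------------------------- the rational number `q = #Ш_an`
  set I := (AddSubgroup.zmultiples P).index with hI_def
  set q : ℚ := 8 * (I : ℚ) ^ 2 * (W.torsionOrder : ℚ) ^ 2 /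
      ((n : ℚ) * (m : ℚ) * ((W.baseChange K).torsionOrder : ℚ) ^ 2 * (Dt.c : ℚ) ^ 2 *
        (Units.torsionOrder K : ℚ) ^ 2 * qd * |(Cd.u : ℚ)| * (W.tamagawaProduct : ℚ)) with hq_def
  ---------------------------------------------------------------- real abbreviations
  set ΩW := W.realPeriodRat with hΩW_def
  set Ωt := (W.quadraticTwist (NumberField.discr K : ℚ)).realPeriodRat with hΩt_def
  set B := (W.baseChange K).bsdPeriod with hB_def
  set R := W.regulator with hR_def
  set hh := P.canonicalHeight with hhh_def
  set tK := (W.baseChange K).torsionOrder with htK_def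
  set tW := W.torsionOrder with htW_def
  set td := Nat.card Wd.toAffine.Point with htd_def
  set Sd := Wd.shaOrder with hSd_def
  set cdd := Wd.tamagawaProduct with hcdd_def
  set cW := W.tamagawaProduct with hcW_def
  set w := Units.torsionOrder K with hw_def
  set cM := Dt.c with hcM_def
  set u := (Cd.u : ℚ) with hu_def
  have hΩW' : ΩW = (W.baseChange ℝ).realPeriod := rfl
  have hΩt' : Ωt = ((W.quadraticTwist (NumberField.discr K : ℚ)).baseChange ℝ).realPeriod := rfl
  rw [← hΩW', ← hΩt'] at hΩ
  -- `B = ΩW Ωt / n`, `ĥ = 2 I² R / (m tK²)`, the Gross–Zagier constant `= 4 B / (c² w²)`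
  have hBeq : B = ΩW * Ωt / n := by
    rw [hΩ]; field_simp
  have hheq : hh = 2 * (I : ℝ) ^ 2 * R / ((m : ℝ) * (tK : ℝ) ^ 2) := by
    rw [← hheight]; field_simp
  have hGZc : 2 * ZLattice.covolume Dt.L.lattice /
        ((cM : ℝ) ^ 2 * ((w : ℝ) / 2) ^ 2 * √|(NumberField.discr K : ℝ)|) =
      4 * B / ((cM : ℝ) ^ 2 * (w : ℝ) ^ 2) := by
    rw [← hper]; field_simp; ring
  -- the `L`-values as real numbers
  have hLdr : Wd.entireLFunction 1 = (((qd : ℝ) * (|(u : ℝ)| * Ωt) : ℝ) : ℂ) := by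
    rw [hLd, hΩd]
  have hLdne : ((qd : ℝ) * (|(u : ℝ)| * Ωt) : ℝ) ≠ 0 := by
    have hu' : |(u : ℝ)| ≠ 0 := abs_ne_zero.mpr (by exact_mod_cast huu)
    have hqd' : (qd : ℝ) ≠ 0 := by exact_mod_cast hqd0
    exact mul_ne_zero hqd' (mul_ne_zero hu' hΩt.ne')
  set X : ℝ := (4 * B / ((cM : ℝ) ^ 2 * (w : ℝ) ^ 2) * hh) / ((qd : ℝ) * (|(u : ℝ)| * Ωt))
    with hX_def
  have hL1 : deriv W.entireLFunction 1 = ((X : ℝ) : ℂ) := by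
    have hne : ((((qd : ℝ) * (|(u : ℝ)| * Ωt) : ℝ)) : ℂ) ≠ 0 := by exact_mod_cast hLdne
    have key : deriv W.entireLFunction 1 * ((((qd : ℝ) * (|(u : ℝ)| * Ωt) : ℝ)) : ℂ) =
        ((4 * B / ((cM : ℝ) ^ 2 * (w : ℝ) ^ 2) * hh : ℝ) : ℂ) := by
      rw [← hLdr, ← hLt', ← hprod, hLD, hGZc]
    rw [hX_def, Complex.ofReal_div, ← key, mul_div_cancel_right₀ _ hne]
  have hshaAnR : shaAn W = ((X * (tW : ℝ) ^ 2 / (ΩW * (cW : ℝ) * R) : ℝ) : ℂ) := by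
    rw [shaAn_def, hlead, hL1]
    push_cast
    rfl
  have hXq : X * (tW : ℝ) ^ 2 / (ΩW * (cW : ℝ) * R) = (q : ℝ) := by
    have hn' : (n : ℝ) ≠ 0 := by exact_mod_cast hn0.ne'
    have hm' : (m : ℝ) ≠ 0 := by exact_mod_cast hm0.ne'
    have htK' : (tK : ℝ) ≠ 0 := by exact_mod_cast htK.ne'
    have htW' : (tW : ℝ) ≠ 0 := by exact_mod_cast htW.ne'
    have hcW' : (cW : ℝ) ≠ 0 := by exact_mod_cast hcW.ne'
    have hcM' : (cM : ℝ) ≠ 0 := by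
      exact_mod_cast (show cM ≠ 0 by rintro h0; exact hc (h0 ▸ dvd_zero (p : ℤ)))
    have hw' : (w : ℝ) ≠ 0 := by exact_mod_cast hw.ne'
    have hu' : |(u : ℝ)| ≠ 0 := abs_ne_zero.mpr (by exact_mod_cast huu)
    have hI' : (I : ℝ) ≠ 0 := by exact_mod_cast hI0
    have hqd' : (qd : ℝ) ≠ 0 := by exact_mod_cast hqd0
    rw [hX_def, hheq, hBeq, hq_def]
    push_cast
    field_simp
    ring
  have hshaAn : shaAn W = (q : ℂ) := by
    rw [hshaAnR, hXq]; norm_cast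
  ---------------------------------------------------------------- `p`-adic valuations
  -- torsion: `v_p(tK) = v_p(tW) + v_p(td)`
  obtain ⟨θ, c, hθ, hcθ⟩ := Quadratic.exists_sq_eq_algebraMap (F := ℚ) (K := K) h2
  obtain ⟨qq, hqq, hdq⟩ := NumberField.exists_discr_eq_mul_sq h2 hθ hcθ
  have htors : padicValNat p tK = padicValNat p tW + padicValNat p td :=
    padicValNat_torsionOrder_baseChange_quadratic W K h2 hθ hcθ hqq hdq ⟨Cd, hWd⟩ p hp2
  -- `Ш`: `v_p(S_K) = v_p(S_W) + v_p(S_d)`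
  have hsha : padicValNat p (W.baseChange K).shaOrder =
      padicValNat p W.shaOrder + padicValNat p Sd := by
    have hcard := card_primaryComponent_sha_baseChange_quadratic_of_odd_of_finite W K h2 Wd
      ⟨Cd, hWd⟩ (W.baseChange K) ⟨1, one_smul _ _⟩ p hp2
    rw [WeierstrassCurve.shaOrder, WeierstrassCurve.shaOrder, hSd_def, WeierstrassCurve.shaOrder,
      ← (Nat.pow_right_injective hpp.two_le).eq_iff, pow_add,
      ← natCard_primaryComponent_eq_pow_padicValNat p, ← natCard_primaryComponent_eq_pow_padicValNat p,
      ← natCard_primaryComponent_eq_pow_padicValNat p]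
    exact hcard
  have hshaW : Nat.card (AddCommGroup.primaryComponent W.sha p) = p ^ padicValNat p W.shaOrder :=
    natCard_primaryComponent_eq_pow_padicValNat p
  -- valuation of `q`
  have hI' : (I : ℚ) ≠ 0 := by exact_mod_cast hI0
  have htW' : (tW : ℚ) ≠ 0 := by exact_mod_cast htW.ne'
  have htK' : (tK : ℚ) ≠ 0 := by exact_mod_cast htK.ne'
  have hn' : (n : ℚ) ≠ 0 := by exact_mod_cast hn0.ne'
  have hm' : (m : ℚ) ≠ 0 := by exact_mod_cast hm0.ne'
  have hcW' : (cW : ℚ) ≠ 0 := by exact_mod_cast hcW.ne'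
  have hw' : (w : ℚ) ≠ 0 := by exact_mod_cast hw.ne'
  have hua : |u| ≠ 0 := abs_ne_zero.mpr huu
  have h8 : padicValRat p (8 : ℚ) = 0 := by
    rw [show (8 : ℚ) = ((8 : ℕ) : ℚ) by norm_num, padicValRat.of_nat]
    have : ¬ p ∣ 8 := by
      intro h
      have h' : p ∣ 2 ^ 3 := by simpa using h
      exact hp2 ((Nat.prime_dvd_prime_iff_eq hpp Nat.prime_two).mp (hpp.dvd_of_dvd_pow h'))
    simp [padicValNat.eq_zero_of_not_dvd this]
  have hvn : padicValRat p (n : ℚ) = 0 := by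
    rw [padicValRat.of_nat]
    have : ¬ p ∣ n := by
      rcases hn with h' | h'
      · rw [h']; exact hpp.one_lt.ne' ∘ Nat.dvd_one.mp
      · rw [h']; intro hd; exact hp2 ((Nat.prime_dvd_prime_iff_eq hpp Nat.prime_two).mp hd)
    simp [padicValNat.eq_zero_of_not_dvd this]
  have hvm : padicValRat p (m : ℚ) = 0 := by
    rw [padicValRat.of_nat]
    have : ¬ p ∣ m := by
      rcases hm with rfl | rfl
      · exact hpp.one_lt.ne' ∘ Nat.dvd_one.mp
      · intro hd
        have h' : p ∣ 2 ^ 2 := by simpa using hd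
        exact hp2 ((Nat.prime_dvd_prime_iff_eq hpp Nat.prime_two).mp (hpp.dvd_of_dvd_pow h'))
    simp [padicValNat.eq_zero_of_not_dvd this]
  have hvc : padicValRat p (cM : ℚ) = 0 := by
    rw [padicValRat.of_int, padicValInt.eq_zero_of_not_dvd hc]; rfl
  have hvw : padicValRat p (w : ℚ) = 0 := by
    rw [padicValRat.of_nat, padicValNat.eq_zero_of_not_dvd hμ]; rfl
  have hvu : padicValRat p |u| = 0 := by
    rcases abs_choice u with h' | h'
    · rw [h']; exact hu
    · rw [h', padicValRat.neg]; exact hu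
  have hvtd : padicValNat p Wd.torsionOrder = padicValNat p td := by rw [htdeq]
  -- `BSD(E,p)`: the rational `#Ш_an(E)` — necessarily `q` — has `ord_p q = ord_p #Ш(E)(p)`
  obtain ⟨-, -, q', hq', hval'⟩ := hbsd
  have hqq : q' = q := by exact_mod_cast hq'.symm.trans hshaAn
  rw [hqq] at hval'
  -- nonvanishing of the partial products
  have hA1 : (8 : ℚ) * (I : ℚ) ^ 2 ≠ 0 := mul_ne_zero (by norm_num) (pow_ne_zero _ hI')
  have hA2 : (8 : ℚ) * (I : ℚ) ^ 2 * (tW : ℚ) ^ 2 ≠ 0 := mul_ne_zero hA1 (pow_ne_zero _ htW')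
  have hD1 : (n : ℚ) * (m : ℚ) ≠ 0 := mul_ne_zero hn' hm'
  have hD2 : (n : ℚ) * (m : ℚ) * (tK : ℚ) ^ 2 ≠ 0 := mul_ne_zero hD1 (pow_ne_zero _ htK')
  have hD3 : (n : ℚ) * (m : ℚ) * (tK : ℚ) ^ 2 * (cM : ℚ) ^ 2 ≠ 0 :=
    mul_ne_zero hD2 (pow_ne_zero _ hcM)
  have hD4 : (n : ℚ) * (m : ℚ) * (tK : ℚ) ^ 2 * (cM : ℚ) ^ 2 * (w : ℚ) ^ 2 ≠ 0 :=
    mul_ne_zero hD3 (pow_ne_zero _ hw')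
  have hD5 : (n : ℚ) * (m : ℚ) * (tK : ℚ) ^ 2 * (cM : ℚ) ^ 2 * (w : ℚ) ^ 2 * qd ≠ 0 :=
    mul_ne_zero hD4 hqd0
  have hD6 : (n : ℚ) * (m : ℚ) * (tK : ℚ) ^ 2 * (cM : ℚ) ^ 2 * (w : ℚ) ^ 2 * qd * |u| ≠ 0 :=
    mul_ne_zero hD5 hua
  have hD7 : (n : ℚ) * (m : ℚ) * (tK : ℚ) ^ 2 * (cM : ℚ) ^ 2 * (w : ℚ) ^ 2 * qd * |u| *
      (cW : ℚ) ≠ 0 := mul_ne_zero hD6 hcW'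
  have hnum : padicValRat p ((8 : ℚ) * (I : ℚ) ^ 2 * (tW : ℚ) ^ 2) =
      2 * padicValNat p I + 2 * padicValNat p tW := by
    rw [padicValRat.mul hA1 (pow_ne_zero _ htW'), padicValRat.mul (by norm_num) (pow_ne_zero _ hI'),
      padicValRat.pow, padicValRat.pow, h8, padicValRat.of_nat, padicValRat.of_nat]
    push_cast; ring
  have hden : padicValRat p ((n : ℚ) * (m : ℚ) * (tK : ℚ) ^ 2 * (cM : ℚ) ^ 2 * (w : ℚ) ^ 2 *
      qd * |u| * (cW : ℚ)) =
      2 * padicValNat p tK + padicValRat p qd + padicValNat p cW := by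
    rw [padicValRat.mul hD6 hcW', padicValRat.mul hD5 hua, padicValRat.mul hD4 hqd0,
      padicValRat.mul hD3 (pow_ne_zero _ hw'), padicValRat.mul hD2 (pow_ne_zero _ hcM),
      padicValRat.mul hD1 (pow_ne_zero _ htK'), padicValRat.mul hn' hm', padicValRat.pow,
      padicValRat.pow, padicValRat.pow, hvn, hvm, hvc, hvw, hvu, padicValRat.of_nat,
      padicValRat.of_nat]
    push_cast; ring
  rw [hshaW, padicValNat.prime_pow, hq_def, padicValRat.div hA2 hD7, hnum, hden, hvqd, hvtd] at hval'
  have e2 := htors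
  have e3 := hsha
  have e4 := htam
  omega


end Summit.BirchSwinnertonDyer.Rank1Residual.X2

end
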